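import Mathlib
import Summits.Ventures.PercRepro2.PosClassCut

/-!
# Transport of the position classes when a MARK or the ROOT lies behind a cut vertex
(blind cell PercRepro2, p5 g8, 2026-08-26; `proofs/P5-POSCLASS.md` §2′, STATUS 02:27:17Z)

`PosClassCut.lean` transports the class statistics `N_s(f_u f_v; w ∈ class)` when the conditioning
vertex `w` lies behind a cut vertex `x`.  Here the other two placements: (i) a MARK `u` behind `x`
(`stat_mark_of_cut`): every class statistic is the `w`-side count `#{u ∈ C_y(x)}` times the same
statistic with `u` replaced by `x` — a scaling, so every sign condition at `(s, x, v, w)` transfers to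
`(s, u, v, w)` (`classPair_mark_of_cut`); (ii) the ROOT `s` behind `x` (`stat_out_root_of_cut`,
`stat_red_root_of_cut`): the class «`x` red-only / blue-only w.r.t. `s`» contributes a one-colour
count (pointwise nonnegative), the class «`x` in both clusters» contributes the statistic with ROOT `x`,
so (TB13) and (OS) at the root `x` give (TB13) and (OS) at the root `s` (`classPair_root_of_cut`).
With `classPair_of_cut` this is the one-step content of the reduction of the pair {(TB13), (OS)} to
the instances where no cut vertex separates any of `s, u, v, w` from the others.  Own work;
standard axioms.
-/

namespace Summit.Ventures.PercRepro2

namespace PosClass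

open CovForm A3InactiveTyped CutV TB14Cut

section Values

variable {V : Type*} {E : Type*} {R : Type*} [Field R]

/-- `iL` takes the values `0` and `1`. -/
lemma iL_eq_zero_or_one (ends : E → Sym2 V) (a v : V) (y : Config E) :
    (iL ends a v y : R) = 0 ∨ (iL ends a v y : R) = 1 := by
  unfold iL
  by_cases h : y ∈ connEvent ends a v
  · right; simp [h]
  · left; simp [h]

end Values

section Mark

variable {V : Type*} {E : Type*} [Fintype E] [DecidableEq E] {R : Type*} [Field R]
  {ends : E → Sym2 V} {x : V} {VA VB : Set V} {EA EB : Set E}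
  [DecidablePred (· ∈ EA)] [DecidablePred (· ∈ EB)]

/-- **A mark behind the cut**: for `u` on the `B`-side and `s, v` on the `A`-side, every class
statistic with an `A`-side class kernel `k` is `#{u ∈ C_y(x)}` (the `B`-side count) times the
statistic with `u` replaced by the cut vertex `x`. -/
theorem stat_mark_of_cut (h : IsCut ends x VA VB EA EB) (F : Finset E) (z : Config E)
    {s u v : V} (hs : s ∈ VA ∪ {x}) (hu : u ∈ VB) (hv : v ∈ VA ∪ {x})
    (k : Config E → Config E → R) (hk : ∀ y y', k y y' = k (restrict EA y) (restrict EA y')) :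
    stat F z ends s u v k =
      pairCount (sideFree EB F) (restrict EB z) (fun y _ => (iL ends x u y : R)) *
        stat (sideFree EA F) (restrict EA z) ends s x v k := by
  have hA : ∀ y : Config E, (iL ends s x y : R) = iL ends s x (restrict EA y) :=
    fun y => iL_restrictA h hs (Or.inr rfl) y
  have hB : ∀ y : Config E, (iL ends x u y : R) = iL ends x u (restrict EB y) :=
    fun y => iL_restrictB h (Or.inr rfl) (Or.inl hu) y
  -- the two product terms
  have e1 := pairCount_mul_of_cut (R := R) h F z
    (fun y y' => iL ends s x y * odd ends s v y y' * k y y') (fun y _ => iL ends x u y)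
    (by intro y y'; rw [hA y, odd_restrictA h hs hv y y', hk y y'])
    (by intro y y'; rw [hB y])
  have e2 := pairCount_mul_of_cut (R := R) h F z
    (fun y y' => iL ends s x y' * odd ends s v y y' * k y y') (fun _ y' => iL ends x u y')
    (by intro y y'; rw [hA y', odd_restrictA h hs hv y y', hk y y'])
    (by intro y y'; rw [hB y'])
  -- the B-side counts of the two copies agree
  have hsw : pairCount (sideFree EB F) (restrict EB z) (fun _ y' => (iL ends x u y' : R)) =
      pairCount (sideFree EB F) (restrict EB z) (fun y _ => (iL ends x u y : R)) := by
    rw [pairCount_swap]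
  -- split the statistic
  have hsplit : stat F z ends s u v k =
      pairCount F z (fun y y' => iL ends s x y * odd ends s v y y' * k y y' * iL ends x u y) -
      pairCount F z (fun y y' => iL ends s x y' * odd ends s v y y' * k y y' * iL ends x u y') := by
    rw [← pairCount_sub]
    unfold stat pairCount
    refine Finset.sum_congr rfl fun y _ => ?_
    split_ifs
    · simp only [odd]
      rw [iL_across h hs hu y, iL_across h hs hu (A3InactiveTyped.flipOn F y)]
      ring
    · rfl
  have hsA : stat (sideFree EA F) (restrict EA z) ends s x v k =
      pairCount (sideFree EA F) (restrict EA z)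
        (fun y y' => iL ends s x y * odd ends s v y y' * k y y') -
      pairCount (sideFree EA F) (restrict EA z)
        (fun y y' => iL ends s x y' * odd ends s v y y' * k y y') := by
    rw [← pairCount_sub]
    unfold stat pairCount
    refine Finset.sum_congr rfl fun y _ => ?_
    split_ifs
    · simp only [odd]
      ring
    · rfl
  rw [hsplit, e1, e2, hsw, hsA]
  ring

omit [Fintype E] [DecidableEq E] [DecidablePred (· ∈ EB)] in
/-- A class kernel of a vertex `w` on the `A`-side only sees the `A`-edges. -/
lemma kOut_restrictA (h : IsCut ends x VA VB EA EB) {s w : V} (hs : s ∈ VA ∪ {x})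
    (hw : w ∈ VA ∪ {x}) (y y' : Config E) :
    (kOut ends s w y y' : R) = kOut ends s w (restrict EA y) (restrict EA y') :=
  kOut_restrict (fun y => iL_restrictA h hs hw y) y y'

omit [Fintype E] [DecidableEq E] [DecidablePred (· ∈ EB)] in
/-- A class kernel of a vertex `w` on the `A`-side only sees the `A`-edges. -/
lemma kRed_restrictA (h : IsCut ends x VA VB EA EB) {s w : V} (hs : s ∈ VA ∪ {x})
    (hw : w ∈ VA ∪ {x}) (y y' : Config E) :
    (kRed ends s w y y' : R) = kRed ends s w (restrict EA y) (restrict EA y') :=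
  kRed_restrict (fun y => iL_restrictA h hs hw y) y y'

omit [Fintype E] [DecidableEq E] [DecidablePred (· ∈ EB)] in
/-- A class kernel of a vertex `w` on the `A`-side only sees the `A`-edges. -/
lemma kBlue_restrictA (h : IsCut ends x VA VB EA EB) {s w : V} (hs : s ∈ VA ∪ {x})
    (hw : w ∈ VA ∪ {x}) (y y' : Config E) :
    (kBlue ends s w y y' : R) = kBlue ends s w (restrict EA y) (restrict EA y') :=
  kBlue_restrict (fun y => iL_restrictA h hs hw y) y y'

variable [LinearOrder R] [IsStrictOrderedRing R]

/-- The `B`-side count `#{u ∈ C_y(x)}` is nonnegative. -/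
lemma pairCount_iL_nonneg (F : Finset E) (z : Config E) (a b : V) :
    0 ≤ pairCount F z (fun y _ => (iL ends a b y : R)) :=
  pairCount_nonneg' F z _ (fun y _ => iL_nonneg ends a b y)

/-- **The pair {(TB13), (OS)} transfers from the cut vertex to a mark behind it**: the signs at
`(s, x, v, w)` on the `s`-side profile give the signs at `(s, u, v, w)`. -/
theorem classPair_mark_of_cut (h : IsCut ends x VA VB EA EB) (F : Finset E) (z : Config E)
    {s u v w : V} (hs : s ∈ VA ∪ {x}) (hu : u ∈ VB) (hv : v ∈ VA ∪ {x}) (hw : w ∈ VA ∪ {x})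
    (hout : 0 ≤ (stat (sideFree EA F) (restrict EA z) ends s x v (kOut ends s w) : R))
    (hosr : 0 ≤ (stat (sideFree EA F) (restrict EA z) ends s x v (kOut ends s w) : R) +
      stat (sideFree EA F) (restrict EA z) ends s x v (kRed ends s w))
    (hosb : 0 ≤ (stat (sideFree EA F) (restrict EA z) ends s x v (kOut ends s w) : R) +
      stat (sideFree EA F) (restrict EA z) ends s x v (kBlue ends s w)) :
    0 ≤ (stat F z ends s u v (kOut ends s w) : R) ∧
    0 ≤ (stat F z ends s u v (kOut ends s w) : R) + stat F z ends s u v (kRed ends s w) ∧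
    0 ≤ (stat F z ends s u v (kOut ends s w) : R) + stat F z ends s u v (kBlue ends s w) := by
  have hρ := pairCount_iL_nonneg (R := R) (ends := ends) (sideFree EB F) (restrict EB z) x u
  rw [stat_mark_of_cut h F z hs hu hv (kOut ends s w) (kOut_restrictA h hs hw),
    stat_mark_of_cut h F z hs hu hv (kRed ends s w) (kRed_restrictA h hs hw),
    stat_mark_of_cut h F z hs hu hv (kBlue ends s w) (kBlue_restrictA h hs hw), ← mul_add, ← mul_add]
  exact ⟨mul_nonneg hρ hout, mul_nonneg hρ hosr, mul_nonneg hρ hosb⟩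

end Mark

section Root

variable {V : Type*} {E : Type*} [Fintype E] [DecidableEq E] {R : Type*} [Field R]
  {ends : E → Sym2 V} {x : V} {VA VB : Set V} {EA EB : Set E}
  [DecidablePred (· ∈ EA)] [DecidablePred (· ∈ EB)]

omit [Fintype E] [DecidableEq E] in
/-- **Across the cut, root on the `B`-side**: `1_{u ∈ C(s)} = 1_{x ∈ C(s)} · 1_{u ∈ C(x)}` for
`s ∈ VB` and `u` on the `A`-side (or `u = x`). -/
lemma iL_across' (h : IsCut ends x VA VB EA EB) {s u : V} (hs : s ∈ VB) (hu : u ∈ VA ∪ {x})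
    (y : Config E) : (iL ends s u y : R) = iL ends s x y * iL ends x u y := by
  rcases hu with hu | hu
  · refine iL_mul_iL_eq ?_
    rw [conn_across_iff h.symm hs hu, ← conn_iff_restrict h.symm (Or.inl hs) (Or.inr rfl),
      ← conn_iff_restrict h (Or.inr rfl) (Or.inl hu)]
  · rw [Set.mem_singleton_iff] at hu
    subst hu
    refine iL_mul_iL_eq ?_
    constructor
    · intro hc; exact ⟨hc, conn_refl _ _ _⟩
    · rintro ⟨hc, _⟩; exact hc

omit [Fintype E] [DecidableEq E] in
/-- The pointwise composition with the root behind the cut, class «outside»: with `b = 1_{x ∈ C_y(s)}`,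
`b' = 1_{x ∈ C_{y'}(s)}` (both `0` or `1`), `f_u f_v · kOut(s, w) = b(1 − b') · r_u r_v (1 − r_w) +
(1 − b) b' · r_u' r_v' (1 − r_w') + b b' · f^x_u f^x_v · kOut(x, w)`. -/
lemma odd_mul_kOut_root (h : IsCut ends x VA VB EA EB) {s u v w : V} (hs : s ∈ VB)
    (hu : u ∈ VA ∪ {x}) (hv : v ∈ VA ∪ {x}) (hw : w ∈ VA ∪ {x}) (y y' : Config E) :
    (odd ends s u y y' * odd ends s v y y' * kOut ends s w y y' : R) =
      kRed ends s x y y' * (iL ends x u y * iL ends x v y * (1 - iL ends x w y)) +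
      kBlue ends s x y y' * (iL ends x u y' * iL ends x v y' * (1 - iL ends x w y')) +
      kCore ends s x y y' * (odd ends x u y y' * odd ends x v y y' * kOut ends x w y y') := by
  unfold odd kOut kRed kBlue kCore
  rw [iL_across' h hs hu y, iL_across' h hs hu y', iL_across' h hs hv y, iL_across' h hs hv y',
    iL_across' h hs hw y, iL_across' h hs hw y']
  rcases iL_eq_zero_or_one (R := R) ends s x y with hb | hb <;>
    rcases iL_eq_zero_or_one (R := R) ends s x y' with hb' | hb' <;> rw [hb, hb'] <;> ring

omit [Fintype E] [DecidableEq E] in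
/-- The pointwise composition with the root behind the cut, class «red-only». -/
lemma odd_mul_kRed_root (h : IsCut ends x VA VB EA EB) {s u v w : V} (hs : s ∈ VB)
    (hu : u ∈ VA ∪ {x}) (hv : v ∈ VA ∪ {x}) (hw : w ∈ VA ∪ {x}) (y y' : Config E) :
    (odd ends s u y y' * odd ends s v y y' * kRed ends s w y y' : R) =
      kRed ends s x y y' * (iL ends x u y * iL ends x v y * iL ends x w y) +
      kCore ends s x y y' * (odd ends x u y y' * odd ends x v y y' * kRed ends x w y y') := by
  unfold odd kRed kCore
  rw [iL_across' h hs hu y, iL_across' h hs hu y', iL_across' h hs hv y, iL_across' h hs hv y',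
    iL_across' h hs hw y, iL_across' h hs hw y']
  rcases iL_eq_zero_or_one (R := R) ends s x y with hb | hb <;>
    rcases iL_eq_zero_or_one (R := R) ends s x y' with hb' | hb' <;> rw [hb, hb'] <;> ring

omit [Fintype E] [DecidableEq E] in
/-- The pointwise composition with the root behind the cut, class «blue-only». -/
lemma odd_mul_kBlue_root (h : IsCut ends x VA VB EA EB) {s u v w : V} (hs : s ∈ VB)
    (hu : u ∈ VA ∪ {x}) (hv : v ∈ VA ∪ {x}) (hw : w ∈ VA ∪ {x}) (y y' : Config E) :
    (odd ends s u y y' * odd ends s v y y' * kBlue ends s w y y' : R) =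
      kBlue ends s x y y' * (iL ends x u y' * iL ends x v y' * iL ends x w y') +
      kCore ends s x y y' * (odd ends x u y y' * odd ends x v y y' * kBlue ends x w y y') := by
  unfold odd kBlue kCore
  rw [iL_across' h hs hu y, iL_across' h hs hu y', iL_across' h hs hv y, iL_across' h hs hv y',
    iL_across' h hs hw y, iL_across' h hs hw y']
  rcases iL_eq_zero_or_one (R := R) ends s x y with hb | hb <;>
    rcases iL_eq_zero_or_one (R := R) ends s x y' with hb' | hb' <;> rw [hb, hb'] <;> ring

omit [Fintype E] [DecidableEq E] [DecidablePred (· ∈ EA)] in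
/-- The class kernels of `x` w.r.t. a root `s` on the `B`-side only see the `B`-edges. -/
lemma iL_sx_restrictB (h : IsCut ends x VA VB EA EB) {s : V} (hs : s ∈ VB) :
    ∀ y : Config E, (iL ends s x y : R) = iL ends s x (restrict EB y) :=
  fun y => iL_restrictB h (Or.inl hs) (Or.inr rfl) y

omit [Fintype E] [DecidableEq E] [DecidablePred (· ∈ EB)] in
/-- `iL x u` only sees the `A`-edges for `u` on the `A`-side. -/
lemma iL_xu_restrictA (h : IsCut ends x VA VB EA EB) {u : V} (hu : u ∈ VA ∪ {x}) :
    ∀ y : Config E, (iL ends x u y : R) = iL ends x u (restrict EA y) :=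
  fun y => iL_restrictA h (Or.inr rfl) hu y

/-- **The root behind the cut, class «outside»**: `out_s(u, v, w) = cRed_B(s, x) · N_A(r_u r_v (1 − r_w))
+ cBlue_B(s, x) · N_A(r_u' r_v' (1 − r_w')) + cCore_B(s, x) · out_x(u, v, w)`. -/
theorem stat_out_root_of_cut (h : IsCut ends x VA VB EA EB) (F : Finset E) (z : Config E)
    {s u v w : V} (hs : s ∈ VB) (hu : u ∈ VA ∪ {x}) (hv : v ∈ VA ∪ {x}) (hw : w ∈ VA ∪ {x}) :
    (stat F z ends s u v (kOut ends s w) : R) =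
      pairCount (sideFree EB F) (restrict EB z) (kRed ends s x) *
        pairCount (sideFree EA F) (restrict EA z)
          (fun y _ => iL ends x u y * iL ends x v y * (1 - iL ends x w y)) +
      pairCount (sideFree EB F) (restrict EB z) (kBlue ends s x) *
        pairCount (sideFree EA F) (restrict EA z)
          (fun _ y' => iL ends x u y' * iL ends x v y' * (1 - iL ends x w y')) +
      pairCount (sideFree EB F) (restrict EB z) (kCore ends s x) *
        stat (sideFree EA F) (restrict EA z) ends x u v (kOut ends x w) := by
  have hB := iL_sx_restrictB (R := R) h hs
  have hAu := iL_xu_restrictA (R := R) h hu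
  have hAv := iL_xu_restrictA (R := R) h hv
  have hAw := iL_xu_restrictA (R := R) h hw
  have e1 := pairCount_mul_of_cut (R := R) h.symm F z (kRed ends s x)
    (fun y _ => iL ends x u y * iL ends x v y * (1 - iL ends x w y))
    (kRed_restrict hB) (by intro y y'; rw [hAu y, hAv y, hAw y])
  have e2 := pairCount_mul_of_cut (R := R) h.symm F z (kBlue ends s x)
    (fun _ y' => iL ends x u y' * iL ends x v y' * (1 - iL ends x w y'))
    (kBlue_restrict hB) (by intro y y'; rw [hAu y', hAv y', hAw y'])
  have e3 := pairCount_mul_of_cut (R := R) h.symm F z (kCore ends s x)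
    (fun y y' => odd ends x u y y' * odd ends x v y y' * kOut ends x w y y')
    (kCore_restrict hB)
    (by intro y y'
        rw [odd_restrictA h (Or.inr rfl) hu y y', odd_restrictA h (Or.inr rfl) hv y y',
          kOut_restrict (fun y => iL_restrictA h (Or.inr rfl) hw y) y y'])
  have hsum : (stat F z ends s u v (kOut ends s w) : R) =
      pairCount F z (fun y y' => kRed ends s x y y' *
        (iL ends x u y * iL ends x v y * (1 - iL ends x w y))) +
      pairCount F z (fun y y' => kBlue ends s x y y' *
        (iL ends x u y' * iL ends x v y' * (1 - iL ends x w y'))) +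
      pairCount F z (fun y y' => kCore ends s x y y' *
        (odd ends x u y y' * odd ends x v y y' * kOut ends x w y y')) := by
    rw [← pairCount_add, ← pairCount_add]
    unfold stat pairCount
    refine Finset.sum_congr rfl fun y _ => ?_
    split_ifs
    · simp only [odd_mul_kOut_root h hs hu hv hw]
    · rfl
  rw [hsum, e1, e2, e3]
  rfl

/-- **The root behind the cut, class «red-only»**: `red_s(u, v, w) = cRed_B(s, x) · N_A(r_u r_v r_w)
+ cCore_B(s, x) · red_x(u, v, w)`. -/
theorem stat_red_root_of_cut (h : IsCut ends x VA VB EA EB) (F : Finset E) (z : Config E)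
    {s u v w : V} (hs : s ∈ VB) (hu : u ∈ VA ∪ {x}) (hv : v ∈ VA ∪ {x}) (hw : w ∈ VA ∪ {x}) :
    (stat F z ends s u v (kRed ends s w) : R) =
      pairCount (sideFree EB F) (restrict EB z) (kRed ends s x) *
        pairCount (sideFree EA F) (restrict EA z)
          (fun y _ => iL ends x u y * iL ends x v y * iL ends x w y) +
      pairCount (sideFree EB F) (restrict EB z) (kCore ends s x) *
        stat (sideFree EA F) (restrict EA z) ends x u v (kRed ends x w) := by
  have hB := iL_sx_restrictB (R := R) h hs
  have hAu := iL_xu_restrictA (R := R) h hu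
  have hAv := iL_xu_restrictA (R := R) h hv
  have hAw := iL_xu_restrictA (R := R) h hw
  have e1 := pairCount_mul_of_cut (R := R) h.symm F z (kRed ends s x)
    (fun y _ => iL ends x u y * iL ends x v y * iL ends x w y)
    (kRed_restrict hB) (by intro y y'; rw [hAu y, hAv y, hAw y])
  have e3 := pairCount_mul_of_cut (R := R) h.symm F z (kCore ends s x)
    (fun y y' => odd ends x u y y' * odd ends x v y y' * kRed ends x w y y')
    (kCore_restrict hB)
    (by intro y y'
        rw [odd_restrictA h (Or.inr rfl) hu y y', odd_restrictA h (Or.inr rfl) hv y y',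
          kRed_restrict (fun y => iL_restrictA h (Or.inr rfl) hw y) y y'])
  have hsum : (stat F z ends s u v (kRed ends s w) : R) =
      pairCount F z (fun y y' => kRed ends s x y y' *
        (iL ends x u y * iL ends x v y * iL ends x w y)) +
      pairCount F z (fun y y' => kCore ends s x y y' *
        (odd ends x u y y' * odd ends x v y y' * kRed ends x w y y')) := by
    rw [← pairCount_add]
    unfold stat pairCount
    refine Finset.sum_congr rfl fun y _ => ?_
    split_ifs
    · simp only [odd_mul_kRed_root h hs hu hv hw]
    · rfl
  rw [hsum, e1, e3]
  rfl

/-- **The root behind the cut, class «blue-only»**. -/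
theorem stat_blue_root_of_cut (h : IsCut ends x VA VB EA EB) (F : Finset E) (z : Config E)
    {s u v w : V} (hs : s ∈ VB) (hu : u ∈ VA ∪ {x}) (hv : v ∈ VA ∪ {x}) (hw : w ∈ VA ∪ {x}) :
    (stat F z ends s u v (kBlue ends s w) : R) =
      pairCount (sideFree EB F) (restrict EB z) (kBlue ends s x) *
        pairCount (sideFree EA F) (restrict EA z)
          (fun _ y' => iL ends x u y' * iL ends x v y' * iL ends x w y') +
      pairCount (sideFree EB F) (restrict EB z) (kCore ends s x) *
        stat (sideFree EA F) (restrict EA z) ends x u v (kBlue ends x w) := by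
  have hB := iL_sx_restrictB (R := R) h hs
  have hAu := iL_xu_restrictA (R := R) h hu
  have hAv := iL_xu_restrictA (R := R) h hv
  have hAw := iL_xu_restrictA (R := R) h hw
  have e2 := pairCount_mul_of_cut (R := R) h.symm F z (kBlue ends s x)
    (fun _ y' => iL ends x u y' * iL ends x v y' * iL ends x w y')
    (kBlue_restrict hB) (by intro y y'; rw [hAu y', hAv y', hAw y'])
  have e3 := pairCount_mul_of_cut (R := R) h.symm F z (kCore ends s x)
    (fun y y' => odd ends x u y y' * odd ends x v y y' * kBlue ends x w y y')
    (kCore_restrict hB)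
    (by intro y y'
        rw [odd_restrictA h (Or.inr rfl) hu y y', odd_restrictA h (Or.inr rfl) hv y y',
          kBlue_restrict (fun y => iL_restrictA h (Or.inr rfl) hw y) y y'])
  have hsum : (stat F z ends s u v (kBlue ends s w) : R) =
      pairCount F z (fun y y' => kBlue ends s x y y' *
        (iL ends x u y' * iL ends x v y' * iL ends x w y')) +
      pairCount F z (fun y y' => kCore ends s x y y' *
        (odd ends x u y y' * odd ends x v y y' * kBlue ends x w y y')) := by
    rw [← pairCount_add]
    unfold stat pairCount
    refine Finset.sum_congr rfl fun y _ => ?_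
    split_ifs
    · simp only [odd_mul_kBlue_root h hs hu hv hw]
    · rfl
  rw [hsum, e2, e3]
  rfl

variable [LinearOrder R] [IsStrictOrderedRing R]

/-- **The pair {(TB13), (OS)} transfers from the root `x` to a root `s` behind the cut.** -/
theorem classPair_root_of_cut (h : IsCut ends x VA VB EA EB) (F : Finset E) (z : Config E)
    {s u v w : V} (hs : s ∈ VB) (hu : u ∈ VA ∪ {x}) (hv : v ∈ VA ∪ {x}) (hw : w ∈ VA ∪ {x})
    (hout : 0 ≤ (stat (sideFree EA F) (restrict EA z) ends x u v (kOut ends x w) : R))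
    (hosr : 0 ≤ (stat (sideFree EA F) (restrict EA z) ends x u v (kOut ends x w) : R) +
      stat (sideFree EA F) (restrict EA z) ends x u v (kRed ends x w))
    (hosb : 0 ≤ (stat (sideFree EA F) (restrict EA z) ends x u v (kOut ends x w) : R) +
      stat (sideFree EA F) (restrict EA z) ends x u v (kBlue ends x w)) :
    0 ≤ (stat F z ends s u v (kOut ends s w) : R) ∧
    0 ≤ (stat F z ends s u v (kOut ends s w) : R) + stat F z ends s u v (kRed ends s w) ∧
    0 ≤ (stat F z ends s u v (kOut ends s w) : R) + stat F z ends s u v (kBlue ends s w) := by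
  have cR := pairCount_nonneg' (R := R) (sideFree EB F) (restrict EB z) (kRed ends s x)
    (kRed_nonneg ends s x)
  have cB := pairCount_nonneg' (R := R) (sideFree EB F) (restrict EB z) (kBlue ends s x)
    (kBlue_nonneg ends s x)
  have cC := pairCount_nonneg' (R := R) (sideFree EB F) (restrict EB z) (kCore ends s x)
    (kCore_nonneg ends s x)
  have t1 := pairCount_nonneg' (R := R) (sideFree EA F) (restrict EA z)
    (fun y _ => iL ends x u y * iL ends x v y * (1 - iL ends x w y)) (fun y _ =>
      mul_nonneg (mul_nonneg (iL_nonneg ends x u y) (iL_nonneg ends x v y))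
        (sub_nonneg.2 (iL_le_one ends x w y)))
  have t2 := pairCount_nonneg' (R := R) (sideFree EA F) (restrict EA z)
    (fun _ y' => iL ends x u y' * iL ends x v y' * (1 - iL ends x w y')) (fun _ y' =>
      mul_nonneg (mul_nonneg (iL_nonneg ends x u y') (iL_nonneg ends x v y'))
        (sub_nonneg.2 (iL_le_one ends x w y')))
  have t3 := pairCount_nonneg' (R := R) (sideFree EA F) (restrict EA z)
    (fun y _ => iL ends x u y * iL ends x v y * iL ends x w y) (fun y _ =>
      mul_nonneg (mul_nonneg (iL_nonneg ends x u y) (iL_nonneg ends x v y)) (iL_nonneg ends x w y))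
  have t4 := pairCount_nonneg' (R := R) (sideFree EA F) (restrict EA z)
    (fun _ y' => iL ends x u y' * iL ends x v y' * iL ends x w y') (fun _ y' =>
      mul_nonneg (mul_nonneg (iL_nonneg ends x u y') (iL_nonneg ends x v y')) (iL_nonneg ends x w y'))
  rw [stat_out_root_of_cut h F z hs hu hv hw, stat_red_root_of_cut h F z hs hu hv hw,
    stat_blue_root_of_cut h F z hs hu hv hw]
  refine ⟨?_, ?_, ?_⟩
  · exact add_nonneg (add_nonneg (mul_nonneg cR t1) (mul_nonneg cB t2)) (mul_nonneg cC hout)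
  · have := mul_nonneg cC hosr
    have h1 := mul_nonneg cR t1
    have h2 := mul_nonneg cB t2
    have h3 := mul_nonneg cR t3
    nlinarith [this, h1, h2, h3]
  · have := mul_nonneg cC hosb
    have h1 := mul_nonneg cR t1
    have h2 := mul_nonneg cB t2
    have h4 := mul_nonneg cB t4
    nlinarith [this, h1, h2, h4]

end Root

end PosClass

end Summit.Ventures.PercRepro2
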